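/-
Copyright (c) 2026 the pub-hodgecm-mathlib formalisation cell (harness21).  Prover seat hodgecm-mathlib-K2Liu-p11 (g0), Track B «K2-LIT»,
#184♮ = hLiu418 = `stmt-HodgeConjecture-24832`; LEAD F0P6-plan (g13) «M-157o» S5-W1-arch FILE 2, road (R)+(C): the recursion in the
scalar type and the EVEN integrals at `s = ½` (Paley–Wiener instances).  THEOREMS ONLY.
-/
import Summits.HodgeConjecture.HodgeConjecture.Theorems.K2LiuRankOneArchWhittakerCentre       -- ★ (this seat): `archScalarSection_J_transl_fin_one`, …
import Summits.HodgeConjecture.HodgeConjecture.Theorems.K2LiuUpperHalfPlaneFourierVanishing   -- ★/📤 (this seat): Paley–Wiener vanishing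
import HarnessLib

/-!
# Crux `HLiu418`, S5-W1-arch FILE 2 (first half): `f⁰_{s,k+2} = f⁰_{s,k} − 2i·f⁰_{s+½,k+1}` on the big cell, and the even types at `s = ½`

Cell `hodgecm-mathlib`, crux item hLiu418 = `stmt-HodgeConjecture-24832` (helper lane `--supports`, count-neutral).

* §1 `archScalarSection_succ_succ` — on `U(1,1)`'s big cell, `f⁰_{s,k+2}(J·n(b)) = f⁰_{s,k}(J·n(b)) − 2i·f⁰_{s+½,k+1}(J·n(b))`
  (`(b−i)/(b+i) = 1 − 2i/(b+i)`): the Whittaker integrals of the odd types telescope down to `k = 1` (★ FILE 1) plus EVEN types at the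
  shifted parameter `s + ½`;
* §2 `archScalarSection_even_half` — at `s = ½` the even type `k = 2j` (`j ≥ 1`) reads `f⁰_{½,2j}(J·n(b)) = (b−i)^{j−1}(b+i)^{−(j+1)}`, a
  rational function holomorphic on the closed upper half-plane with `‖·‖ ≤ 1/(1+‖b‖²)` there (`differentiableAt_evenKernel`, `norm_evenKernel_le`);
* §3 `integral_archScalarSection_even_half_eq_zero (hj : 1 ≤ j) (hh : h < 0) : ∫_ℝ f⁰_{½,2j}(J·n(b)) e^{−2πihb} db = 0` — ABSOLUTELY
  convergent and zero for the wrong sign, by ★ `fourier_eq_zero_of_differentiable_upperHalfPlane`.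
What remains for the full FILE 2 (odd `k ≥ 3` continued central value `= 0`): holomorphy in `s` of the even integrals `s ↦ W^{(2j)}_h(s+½)` on
`{−½ < re s}` (differentiation under the integral), so that the telescoped closed form IS the continuation — recorded, not typed here.
References: [Bump1997, §1.6] (derived).
HONEST LABEL: HC_CM is proved only modulo the 7 printed citations (2 remaining named inputs: hLiu418 = stmt-HodgeConjecture-24832,
h413 = stmt-HodgeConjecture-24833) until rung 0 closes; count-neutral helper, closes no socket.
-/

set_option autoImplicit false
set_option linter.dupNamespace false

noncomputable section

open Complex MeasureTheory Set Filter
open scoped ComplexOrder Topology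

namespace Summit.HodgeConjecture.HodgeConjecture.Cruxes.HLiu418.K2LiuRankOneArchWhittakerEven

open Summit.HodgeConjecture.HodgeConjecture.Cruxes.HLiu418.K2LiuArchInducedTubeDefs
open Summit.HodgeConjecture.HodgeConjecture.Cruxes.HLiu418.K2LiuRankOneArchWhittakerCentre
open Summit.HodgeConjecture.HodgeConjecture.Cruxes.HLiu418.K2LiuUpperHalfPlaneFourierVanishing

/-! ## §1  The recursion in the scalar type -/

/-- `β + i ≠ 0` for real `β`. [folklore] -/
theorem ofReal_add_I_ne_zero (β : ℝ) : (β : ℂ) + I ≠ 0 := by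
  intro h
  have := congrArg Complex.im h
  simp at this

/-- `0 < ‖β + i‖` for real `β`. [folklore] -/
theorem norm_ofReal_add_I_pos (β : ℝ) : 0 < ‖(β : ℂ) + I‖ := norm_pos_iff.2 (ofReal_add_I_ne_zero β)

/-- **THE RECURSION**: `f⁰_{s,k+2}(J·n(β)) = f⁰_{s,k}(J·n(β)) − 2i·f⁰_{s+½,k+1}(J·n(β))` on the big cell of `U(1,1)`
(`|β+i|² = (β+i)(β−i)`, `(β−i)/(β+i) = 1 − 2i/(β+i)`). [Bump1997, §1.6] -/
theorem archScalarSection_succ_succ (k : ℤ) (s : ℂ) (β : ℝ) :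
    archScalarSection (k + 2) s (Matrix.J (Fin 1) ℂ * Matrix.fromBlocks 1 ((β : ℂ) • (1 : Matrix (Fin 1) (Fin 1) ℂ)) 0 1) =
      archScalarSection k s (Matrix.J (Fin 1) ℂ * Matrix.fromBlocks 1 ((β : ℂ) • (1 : Matrix (Fin 1) (Fin 1) ℂ)) 0 1) -
        2 * I * archScalarSection (k + 1) (s + 1 / 2) (Matrix.J (Fin 1) ℂ * Matrix.fromBlocks 1 ((β : ℂ) • (1 : Matrix (Fin 1) (Fin 1) ℂ)) 0 1) := by
  have hz := ofReal_add_I_ne_zero β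
  have hn0 : ((‖(β : ℂ) + I‖ : ℝ) : ℂ) ≠ 0 := by exact_mod_cast (norm_ofReal_add_I_pos β).ne'
  rw [archScalarSection_J_transl_fin_one, archScalarSection_J_transl_fin_one, archScalarSection_J_transl_fin_one]
  push_cast
  -- normalise the three exponents of `|β+i|` to a common one
  have e1 : ((‖(β : ℂ) + I‖ : ℝ) : ℂ) ^ ((k : ℂ) + 2 - 2 * s - 1) = ((‖(β : ℂ) + I‖ : ℝ) : ℂ) ^ ((k : ℂ) - 2 * s - 1) * ((‖(β : ℂ) + I‖ : ℝ) : ℂ) ^ (2 : ℂ) := by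
    rw [← Complex.cpow_add _ _ hn0]
    congr 1
    ring
  have e2 : ((‖(β : ℂ) + I‖ : ℝ) : ℂ) ^ ((k : ℂ) + 1 - 2 * (s + 1 / 2) - 1) = ((‖(β : ℂ) + I‖ : ℝ) : ℂ) ^ ((k : ℂ) - 2 * s - 1) := by
    congr 1
    ring
  have hsq : ((‖(β : ℂ) + I‖ : ℝ) : ℂ) ^ (2 : ℂ) = ((β : ℂ) + I) * ((β : ℂ) - I) := by
    rw [show (2 : ℂ) = ((2 : ℕ) : ℂ) by norm_num, Complex.cpow_natCast]
    rw [show (((‖(β : ℂ) + I‖ : ℝ) : ℂ)) ^ 2 = (((‖(β : ℂ) + I‖ ^ 2 : ℝ)) : ℂ) by push_cast; ring, Complex.sq_norm,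
      show ((β : ℂ) + I) = (β : ℂ) + (1 : ℝ) * I by simp, Complex.normSq_add_mul_I]
    push_cast
    linear_combination I_mul_I
  rw [e1, e2, hsq, show (-(k + 2) : ℤ) = -k + -2 by ring, show (-(k + 1) : ℤ) = -k + -1 by ring, zpow_add₀ hz, zpow_add₀ hz]
  have hm2 : ((β : ℂ) + I) ^ (-2 : ℤ) = (((β : ℂ) + I) ^ 2)⁻¹ := by
    rw [show (-2 : ℤ) = -((2 : ℕ) : ℤ) by norm_num, zpow_neg, zpow_natCast]
  have hm1 : ((β : ℂ) + I) ^ (-1 : ℤ) = ((β : ℂ) + I)⁻¹ := zpow_neg_one _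
  rw [hm2, hm1]
  field_simp
  ring

/-! ## §2  The even types at `s = ½`: a rational kernel holomorphic on the closed upper half-plane -/

/-- **THE EVEN TYPE AT `s = ½`**: `f⁰_{½,2j}(J·n(β)) = (β−i)^{j−1}·(β+i)^{−(j+1)}` (`j ≥ 1`). -/
theorem archScalarSection_even_half {j : ℕ} (hj : 1 ≤ j) (β : ℝ) :
    archScalarSection (2 * (j : ℤ)) (1 / 2) (Matrix.J (Fin 1) ℂ * Matrix.fromBlocks 1 ((β : ℂ) • (1 : Matrix (Fin 1) (Fin 1) ℂ)) 0 1) =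
      ((β : ℂ) - I) ^ (j - 1) * (((β : ℂ) + I) ^ (j + 1))⁻¹ := by
  have hz := ofReal_add_I_ne_zero β
  have hn0 : ((‖(β : ℂ) + I‖ : ℝ) : ℂ) ≠ 0 := by exact_mod_cast (norm_ofReal_add_I_pos β).ne'
  rw [archScalarSection_J_transl_fin_one]
  push_cast
  have hexp : ((2 : ℂ) * (j : ℂ) - 2 * (1 / 2) - 1) = (((2 * (j - 1) : ℕ)) : ℂ) := by
    rw [Nat.cast_mul, Nat.cast_sub hj]
    push_cast
    ring
  have hsq : ((‖(β : ℂ) + I‖ : ℝ) : ℂ) ^ 2 = ((β : ℂ) + I) * ((β : ℂ) - I) := by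
    rw [show (((‖(β : ℂ) + I‖ : ℝ) : ℂ)) ^ 2 = (((‖(β : ℂ) + I‖ ^ 2 : ℝ)) : ℂ) by push_cast; ring, Complex.sq_norm,
      show ((β : ℂ) + I) = (β : ℂ) + (1 : ℝ) * I by simp, Complex.normSq_add_mul_I]
    push_cast
    linear_combination I_mul_I
  rw [hexp, Complex.cpow_natCast, pow_mul, hsq, mul_pow, show (2 * (j : ℤ)) = ((2 * j : ℕ) : ℤ) by push_cast; ring, zpow_neg,
    zpow_natCast]
  -- `(β+i)^{−2j}·(β+i)^{j−1}(β−i)^{j−1} = (β−i)^{j−1}(β+i)^{−(j+1)}`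
  have hpow : ((β : ℂ) + I) ^ (2 * j) = ((β : ℂ) + I) ^ (j - 1) * ((β : ℂ) + I) ^ (j + 1) := by
    rw [← pow_add]
    congr 1
    omega
  rw [hpow, mul_inv]
  have hu : ((β : ℂ) + I) ^ (j - 1) ≠ 0 := pow_ne_zero _ hz
  field_simp

/-- The even kernel `z ↦ (z−i)^{j−1}(z+i)^{−(j+1)}` is complex-differentiable at every point of the closed upper half-plane. [folklore] -/
theorem differentiableAt_evenKernel (j : ℕ) {z : ℂ} (hz : 0 ≤ z.im) :
    DifferentiableAt ℂ (fun z : ℂ => (z - I) ^ (j - 1) * ((z + I) ^ (j + 1))⁻¹) z := by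
  have hne : (z + I) ^ (j + 1) ≠ 0 := by
    refine pow_ne_zero _ ?_
    intro h
    have := congrArg Complex.im h
    simp at this
    linarith
  exact ((differentiableAt_id.sub_const I).pow _).mul (((differentiableAt_id.add_const I).pow _).inv hne)

/-- The bound `‖(z−i)^{j−1}(z+i)^{−(j+1)}‖ ≤ 1/(1+‖z‖²)` on the closed upper half-plane (`|z−i| ≤ |z+i|`, `|z+i|² ≥ 1+|z|²` there). [folklore] -/
theorem norm_evenKernel_le {j : ℕ} (hj : 1 ≤ j) {z : ℂ} (hz : 0 ≤ z.im) :
    ‖(z - I) ^ (j - 1) * ((z + I) ^ (j + 1))⁻¹‖ ≤ 1 / (1 + ‖z‖ ^ 2) := by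
  have hb2 : 1 + ‖z‖ ^ 2 ≤ ‖z + I‖ ^ 2 := by
    rw [Complex.sq_norm, Complex.sq_norm, Complex.normSq_apply, Complex.normSq_apply]
    simp
    nlinarith
  have hb : 0 < ‖z + I‖ := by
    have h1 : 0 < ‖z + I‖ ^ 2 := by nlinarith [sq_nonneg ‖z‖]
    nlinarith [norm_nonneg (z + I)]
  have hab : ‖z - I‖ ≤ ‖z + I‖ := by
    have ha : ‖z - I‖ ^ 2 ≤ ‖z + I‖ ^ 2 := by
      rw [Complex.sq_norm, Complex.sq_norm, Complex.normSq_apply, Complex.normSq_apply]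
      simp
      nlinarith
    nlinarith [norm_nonneg (z - I), norm_nonneg (z + I)]
  rw [norm_mul, norm_inv, norm_pow, norm_pow]
  calc ‖z - I‖ ^ (j - 1) * (‖z + I‖ ^ (j + 1))⁻¹ ≤ ‖z + I‖ ^ (j - 1) * (‖z + I‖ ^ (j + 1))⁻¹ :=
        mul_le_mul_of_nonneg_right (pow_le_pow_left₀ (norm_nonneg _) hab _) (inv_nonneg.2 (pow_nonneg (norm_nonneg _) _))
    _ = (‖z + I‖ ^ 2)⁻¹ := by
        rw [show j + 1 = (j - 1) + 2 by omega, pow_add, mul_inv, ← mul_assoc, mul_inv_cancel₀ (pow_ne_zero _ hb.ne'), one_mul]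
    _ ≤ 1 / (1 + ‖z‖ ^ 2) := by
        rw [one_div]
        exact inv_anti₀ (by positivity) hb2

/-! ## §3  The even Whittaker integrals at `s = ½` vanish for the wrong sign -/

/-- **EVEN TYPES, `s = ½`, WRONG SIGN**: for `j ≥ 1` and `h < 0`, `∫_ℝ f⁰_{½,2j}(J·n(β))·e^{−2πihβ} dβ = 0` (absolutely convergent;
Paley–Wiener on the closed upper half-plane, ★ `fourier_eq_zero_of_differentiable_upperHalfPlane`). [Bump1997, §1.6] -/
theorem integral_archScalarSection_even_half_eq_zero {j : ℕ} (hj : 1 ≤ j) {h : ℝ} (hh : h < 0) :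
    ∫ β : ℝ, archScalarSection (2 * (j : ℤ)) (1 / 2) (Matrix.J (Fin 1) ℂ * Matrix.fromBlocks 1 ((β : ℂ) • (1 : Matrix (Fin 1) (Fin 1) ℂ)) 0 1) *
        Complex.exp (-(2 * Real.pi * I * h * β)) = 0 := by
  have hF : ∀ z : ℂ, 0 ≤ z.im → DifferentiableAt ℂ (fun z : ℂ => (z - I) ^ (j - 1) * ((z + I) ^ (j + 1))⁻¹) z :=
    fun z hz => differentiableAt_evenKernel j hz
  have hB : ∀ z : ℂ, 0 ≤ z.im → ‖(fun z : ℂ => (z - I) ^ (j - 1) * ((z + I) ^ (j + 1))⁻¹) z‖ ≤ 1 / (1 + ‖z‖ ^ 2) :=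
    fun z hz => norm_evenKernel_le hj hz
  have h0 := fourier_eq_zero_of_differentiable_upperHalfPlane hF hB hh
  rw [← h0]
  refine integral_congr_ae (Filter.Eventually.of_forall fun β => ?_)
  simp only [archScalarSection_even_half hj]

end Summit.HodgeConjecture.HodgeConjecture.Cruxes.HLiu418.K2LiuRankOneArchWhittakerEven

end
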